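import Literature.MathematicalPhysics.QuantumFieldTheory.Balaban1983to89.B8Thm32GBoundDentedCubeMember

/-!
# `Balaban1983to89.B8Real1DentedCubeMember` — [Balaban1985RegularSpaces] (1.101) FOR `T⁻¹` (= [Balaban1985BackgroundPropagators] THEOREM 3.1 (3.47) AT `U = 1`) ON THE
# DENTED CUBE MEMBER `{Ω′_j}` OF [Balaban1985Variational] (148)–(150), TOP TRUNCATION — REAL-1 (exponents `−2 → 0, −1`) AND REAL-1′ (exponents `−4 → −2`), NAMED

statement-level skeleton of published theorems with citation tags; proofs where landed; nothing here is a claim about the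
Yang–Mills mass gap

`[Balaban1985RegularSpaces]` ("B8" = [6], CMP **99** (1985) 75–102) (1.101) p. 93 («|G′λ|, |∇G′λ| …»), (1.91)–(1.92) p. 91, p. 98; `[Balaban1985BackgroundPropagators]` ("[4]",
CMP **99** (1985) 389–434) Theorem 3.1 (3.47) p. 398 (the propagator `G′(U) = (Δ_U^η + Q′*aQ′)⁻¹` of the multi-level operator, weighted sup bounds with exponential decay);
`[Balaban1985Variational]` ("[15]", CMP **102** (1985) 277–309) (148)–(150) p. 301 («… for the sequence {Ω′_j} instead of {Ω_j}»); `[Balaban1984PropagatorsII]` ("B6") Prop.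
2.3 (2.87) p. 238.  PDF held: `paper:balaban1985-cmp99-regular-spaces-gauge-fixing`, `paper:balaban1985-cmp102-variational-background`.

CITATION HEADER (lean-in-tree rule).  Cell `pub-ymgap` (YM Track A, HUMAN RULING D-0062), DAG node N05 = [B8], seat `pub-ymgap-dag-n05-e` (g31; FAN-OUT §N05 row s3b,
Proposition-6 lane; the (β) road over NODE 00's `CubeB8D`, p655171).  WHY THIS FILE.  The (β) crown `B8Prop6DentedCubeMemberScalarGammaOfNamedFacts` ((d3)-13) takes
the flat consumer's three REAL families at the top truncation of a dented member as ONE named fact `Real123DentedCubeMemberPrinted` ((d3)-12).  On the PURE member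
dag-n05-c proved REAL-1 ∕ REAL-1′ by the parametrix (`B8Eq1101CubeMemberWeights.ineq1101_cubeMember_real_printed`, `B8Eq1101CubeMemberRealM4.ineq1101_cubeMember_m4_printed`,
≈ 2.7 kLoC keyed on `cubeDomains ∕ cubeLamS`) and REDUCED REAL-2 ∕ REAL-3 to them plus the 𝒢-bound by algebra (`B8Prop6CubeMemberRealOfGBound`).  The dented reductions
are (d3)-14 ∕ (d3)-15 (`B8Eq192DentedCubeMemberOfReal1G`, `B8Eq198DentedCubeMemberOfReal12`); THIS FILE names their two analytic inputs at the top truncation of the dented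
member: `Real1DentedCubeMemberPrinted d ℓ` (REAL-1) and `Real1M4DentedCubeMemberPrinted d ℓ` (REAL-1′) = the bodies of the two pure THEOREMS at `n = k` VERBATIM under
`cubeFam false … j ↦ c.sq j`, `cubeLamS … k ↦ c.lamS`, `(a, M, ρ, k) ↦ c`'s fields, side conditions verbatim, PLUS p661669's anchored dent premise (threshold positivity
dropped).  With them and `GBoundDentedCubeMemberPrinted` (p661669), `B8Prop6DentedCubeMemberScalarGammaOfGBound` ((d3)-17) DERIVES `Real123DentedCubeMemberPrinted`.

WHAT THIS FILE DECLARES.  Two `def … : Prop` — NOT axioms, NOT proved here (OPEN in the tree: their proofs are the dented twins of the parametrix files, reading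
`B8CubeMemberTorusDomainsDented` ∕ a dented box member); nothing consumes them silently.  HONEST SCOPE ∕ NOT CLAIMED.  Named published estimates on the dented member;
nothing of [4]∕[6]∕[15] asserted as a theorem; count-neutral; N05 ∕ N07 NOT discharged; one finite `T⁴` programme at fixed `ε`, Bałaban as printed; nothing continuum ∕ ℝ⁴ ∕
OS ∕ mass-gap ∕ Clay.  No `sorry`, no `instance`, no `notation`; two `def`s (`Prop`s).  Unit `pub-ymgap-dag-n05-e` (g31), 2026-08-28.

RELATED IN THE TREE, NOT DUPLICATED (`rg` 2026-08-28T21:00Z: `ls Balaban1983to89 | grep -ci 'Real1Dented'` = 0): the two pure theorems (models), `Real123DentedCubeMemberPrinted`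
((d3)-12; the coarser sibling, DERIVED from these + p661669 in (d3)-17), `GBoundDentedCubeMemberPrinted` (p661669), `Node00.CubeB8D ∕ .sq ∕ .lamS` (p655171; USED),
`B8Eq1101CubeMemberWeights.wPrinted` (USED).
-/
noncomputable section

namespace Literature.MathematicalPhysics.QuantumFieldTheory.Balaban1983to89.B8Real1DentedCubeMember

open scoped Matrix
open B7Prop1Explicit (e)
open B8Eq140Level (SideTouches)
open B8LambdaSpaceKLevel (wt)
open B8Eq1101CubeMemberWeights (wPrinted)
open Node00 (CubeB8D)
open Literature.MathematicalPhysics.QuantumLattice (blockMap)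

open Classical in
/-- **[Balaban1985RegularSpaces] (1.101) FOR `T⁻¹ = G′(1)`, EXPONENTS `−2 → 0` (function) AND `−2 → −1` (gradient), ON THE DENTED CUBE MEMBER `{Ω′_j}`, TOP TRUNCATION —
REAL-1** ([4] Theorem 3.1 (3.47) at `U = 1` for «the sequence {Ω′_j} instead of {Ω_j}», [15] p. 301).  For the explicit matrix `T = (K(x,z))` of the flat consumer at print's
weights `wPrinted` (`L = ℓ + 1`, dimension `d + 1`) on the dented data (sites `S = Ω′₀ = □₀ = c.sq 0`, site operator weighted on the dented cells `c.lamS`): a constant `B_G > 0`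
and thresholds such that on print's sub-lattice (side conditions as in `GBoundDentedCubeMemberPrinted`, anchored dent premise) a source `ρ′` with `(Lʲη)²|ρ′| ≤ r` on `Ω′_j`
has `|T⁻¹ρ′| ≤ B_G r` and `(Lʲη)|∇^η T⁻¹ρ′| ≤ B_G r` on the bonds touching `Ω′_j`.  The body of dag-n05-c's THEOREM `ineq1101_cubeMember_real_printed d ℓ` at `n = k` under
`cubeFam false … j ↦ c.sq j`, `cubeLamS … k ↦ c.lamS`.  OPEN in the tree.
[cite: Balaban1985RegularSpaces, (1.101) p.93, (1.91)–(1.92) p.91, p.98, (1.4) p.77; Balaban1985BackgroundPropagators, Theorem 3.1 (3.47) p.398; Balaban1985Variational, (148)–(151) p.301; Balaban1984PropagatorsII, Prop. 2.3 (2.87) p.238] -/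
def Real1DentedCubeMemberPrinted (d ℓ : ℕ) : Prop :=
  ∃ BG ρ₀ M₀ : ℝ, ∃ N₀ : ℕ, 0 < BG ∧
    ∀ (η : ℝ), 0 < η → ∀ (Mh : ℕ), 3 ≤ Mh → M₀ ≤ ((ℓ : ℝ) + 1) * Mh →
    ∀ (K' : ℕ) (Ω : ℕ → Set (Fin (d + 1) → ℤ)) (c : CubeB8D (d + 1) (ℓ + 1) K' Ω) (R : ℕ),
      Mh * (ℓ + 1) ∣ c.ρ → Mh * (ℓ + 1) ∣ c.M → R * (Mh * (ℓ + 1)) ≤ c.ρ → 2 * (ℓ + 1) ≤ R → N₀ + 1 ≤ R * ((ℓ + 1) * Mh) → ρ₀ ≤ (c.ρ : ℝ) →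
      (∀ x y : Fin (d + 1) → ℤ,
          blockMap (Mh * (ℓ + 1) ^ (c.k + 1)) (x - fun i => (((ℓ + 1 : ℕ) : ℤ)) ^ c.k * (c.a i - c.ρ)) =
            blockMap (Mh * (ℓ + 1) ^ (c.k + 1)) (y - fun i => (((ℓ + 1 : ℕ) : ℤ)) ^ c.k * (c.a i - c.ρ)) → x ∈ Ω c.k → y ∈ Ω c.k) →
      ∀ (S : Finset (Fin (d + 1) → ℤ)), (∀ z, z ∈ S ↔ z ∈ c.sq 0) →
      ∀ (K : (Fin (d + 1) → ℤ) → (Fin (d + 1) → ℤ) → ℝ), (∀ x z, K x z =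
          ((η ^ 2)⁻¹ * ∑ μ : Fin (d + 1), ((2 : ℝ) * (if z = x then (1 : ℝ) else 0) - (if z = x + e μ then (1 : ℝ) else 0)
            - (if z = x - e μ then (1 : ℝ) else 0))) +
          (∑ j ∈ Finset.range (c.k + 1), (if blockMap ((ℓ + 1) ^ j) x ∈ c.lamS j ∧
              blockMap ((ℓ + 1) ^ j) z = blockMap ((ℓ + 1) ^ j) x then
            wPrinted d ℓ η j * (((((ℓ + 1 : ℕ) : ℝ) ^ (d + 1))⁻¹) ^ j) ^ 2 else 0))) →
      ∀ (T : Matrix ↥S ↥S ℝ), T = Matrix.of (fun x z : ↥S => K x.1 z.1) →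
      ∀ (ρ' : ↥S → ℝ) (r : ℝ), 0 ≤ r →
        (∀ j, j ≤ c.k → ∀ z : ↥S, z.1 ∈ c.sq j → wt (ℓ + 1) η j ^ 2 * |ρ' z| ≤ r) →
        ∀ φ : (Fin (d + 1) → ℤ) → ℝ, (∀ x, x ∉ c.sq 0 → φ x = 0) →
          (∀ v : ↥S, φ v.1 = ∑ z : ↥S, T⁻¹ v z * ρ' z) →
          (∀ x, |φ x| ≤ BG * r) ∧
          ∀ j, j ≤ c.k → ∀ p ∈ {b : (Fin (d + 1) → ℤ) × Fin (d + 1) | SideTouches (c.sq j) b.1 b.2},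
            wt (ℓ + 1) η j * |η⁻¹ * (φ (p.1 + e p.2) - φ p.1)| ≤ BG * r

open Classical in
/-- **[Balaban1985RegularSpaces] (1.101) FOR `T⁻¹ = G′(1)` AT PRINT's EXPONENT `γ = −4` (`−4 → −2`, function member), ON THE DENTED CUBE MEMBER `{Ω′_j}`, TOP TRUNCATION —
REAL-1′** ([4] Theorem 3.1 (3.47) at `U = 1`, [15] p. 301).  Same data as `Real1DentedCubeMemberPrinted`; a source `u` with `(Lʲη)⁴|u| ≤ r` on `Ω′_j` has `(Lʲη)²|T⁻¹u| ≤ B_G′ r`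
on `Ω′_j`.  The body of dag-n05-c's THEOREM `ineq1101_cubeMember_m4_printed d ℓ` at `n = k` under the dented letter map.  OPEN in the tree.
[cite: Balaban1985RegularSpaces, (1.101) p.93, (1.91)–(1.92) p.91, p.98; Balaban1985BackgroundPropagators, Theorem 3.1 (3.47) p.398; Balaban1985Variational, (148)–(151) p.301; Balaban1984PropagatorsII, Prop. 2.3 (2.87) p.238] -/
def Real1M4DentedCubeMemberPrinted (d ℓ : ℕ) : Prop :=
  ∃ BG ρ₀ M₀ : ℝ, ∃ N₀ : ℕ, 0 < BG ∧
    ∀ (η : ℝ), 0 < η → ∀ (Mh : ℕ), 3 ≤ Mh → M₀ ≤ ((ℓ : ℝ) + 1) * Mh →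
    ∀ (K' : ℕ) (Ω : ℕ → Set (Fin (d + 1) → ℤ)) (c : CubeB8D (d + 1) (ℓ + 1) K' Ω) (R : ℕ),
      Mh * (ℓ + 1) ∣ c.ρ → Mh * (ℓ + 1) ∣ c.M → R * (Mh * (ℓ + 1)) ≤ c.ρ → 2 * (ℓ + 1) ≤ R → N₀ + 1 ≤ R * ((ℓ + 1) * Mh) → ρ₀ ≤ (c.ρ : ℝ) →
      (∀ x y : Fin (d + 1) → ℤ,
          blockMap (Mh * (ℓ + 1) ^ (c.k + 1)) (x - fun i => (((ℓ + 1 : ℕ) : ℤ)) ^ c.k * (c.a i - c.ρ)) =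
            blockMap (Mh * (ℓ + 1) ^ (c.k + 1)) (y - fun i => (((ℓ + 1 : ℕ) : ℤ)) ^ c.k * (c.a i - c.ρ)) → x ∈ Ω c.k → y ∈ Ω c.k) →
      ∀ (S : Finset (Fin (d + 1) → ℤ)), (∀ z, z ∈ S ↔ z ∈ c.sq 0) →
      ∀ (K : (Fin (d + 1) → ℤ) → (Fin (d + 1) → ℤ) → ℝ), (∀ x z, K x z =
          ((η ^ 2)⁻¹ * ∑ μ : Fin (d + 1), ((2 : ℝ) * (if z = x then (1 : ℝ) else 0) - (if z = x + e μ then (1 : ℝ) else 0)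
            - (if z = x - e μ then (1 : ℝ) else 0))) +
          (∑ j ∈ Finset.range (c.k + 1), (if blockMap ((ℓ + 1) ^ j) x ∈ c.lamS j ∧
              blockMap ((ℓ + 1) ^ j) z = blockMap ((ℓ + 1) ^ j) x then
            wPrinted d ℓ η j * (((((ℓ + 1 : ℕ) : ℝ) ^ (d + 1))⁻¹) ^ j) ^ 2 else 0))) →
      ∀ (T : Matrix ↥S ↥S ℝ), T = Matrix.of (fun x z : ↥S => K x.1 z.1) →
      ∀ (u : ↥S → ℝ) (r : ℝ), 0 ≤ r →
        (∀ j, j ≤ c.k → ∀ z : ↥S, z.1 ∈ c.sq j → wt (ℓ + 1) η j ^ 4 * |u z| ≤ r) →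
        ∀ j, j ≤ c.k → ∀ v : ↥S, v.1 ∈ c.sq j →
          wt (ℓ + 1) η j ^ 2 * |∑ z : ↥S, T⁻¹ v z * u z| ≤ BG * r

end Literature.MathematicalPhysics.QuantumFieldTheory.Balaban1983to89.B8Real1DentedCubeMember

end
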